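import Mathlib.FieldTheory.IsAlgClosed.AlgebraicClosure
import Mathlib.FieldTheory.Galois.Basic
import Mathlib.NumberTheory.NumberField.Basic
import Mathlib.NumberTheory.Cyclotomic.Basic
import Mathlib.RingTheory.RootsOfUnity.AlgebraicallyClosed
import Mathlib.FieldTheory.LinearDisjoint
import HarnessLib

/-!
# Cube roots of unity in `K̄` and the automorphisms of `K̄/ℚ` used in Scholz's reflection theorem

Topic `NumberTheory/NumberFields`.  Theorem-only file (no definition, no named fact).

Elementary field theory inside an algebraic closure `K̄` of a number field `K` that does not contain
the cube roots of unity (`ζ ∉ K`, `ζ` a primitive cube root of unity in `K̄`), as used in the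
Kummer-theoretic proof of Scholz's reflection theorem (Washington, *Introduction to Cyclotomic
Fields*, proof of Thm. 10.10, with `L = K(ζ₃)`, `[L:K] = 2`, `Gal(L/ℚ) = {1, σ, τ, στ}`):

* `minpoly_eq`, `finrank_adjoin_eq_two`, `isGalois_adjoin` — `minpoly_K ζ = X² + X + 1`,
  `[K(ζ):K] = 2`, `K(ζ)/K` Galois;
* `eq_of_pow_three_eq_one`, `apply_eq_sq_of_pow_three_eq_one` — the cube roots of unity are
  `1, ζ, ζ²`, and an automorphism with `ζ ↦ ζ²` inverts all of them;
* `exists_algEquiv_apply_eq_sq` — there is `φ ∈ Aut(K̄/K)` with `φ(ζ) = ζ²`;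
* `exists_algEquiv_restrictNormal_ne_one` — for `K` quadratic there is `g ∈ Aut(K̄/ℚ)` which is
  non-trivial on `K` AND maps `ζ ↦ ζ²` (Washington's `στ`, the generator of `Gal(L/ℚ(√-3d))`);
* `apply_mem_adjoin_of`, `apply_apply_eq_self_of_mem_adjoin` — such a `g` preserves `K(ζ)` and
  `g²` is the identity on `K(ζ)`;
* `eqOn_sup`, `apply_mem_sup_of` — automorphisms agreeing on (mapping into a field) two
  intermediate fields do so on their compositum;
* `finrank_sup_adjoin_eq` — `[E(ζ):K] = 6` for a cubic `E/K`;
* `eq_of_le_sup_adjoin` — two cubic Galois extensions `E₁, E₂` of `K` with `E₁ ⊆ E₂(ζ)` coincide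
  (otherwise `ζ ∈ E₁E₂`, which is fixed by `φ³` for every `φ ∈ Aut(K̄/K)`, while `φ³(ζ) = ζ²` for
  the `φ` above).

## References

* L. C. Washington, *Introduction to Cyclotomic Fields*, GTM 83, 2nd ed. (1997), proof of
  Thm. 10.10. [Washington1997]
-/

noncomputable section

open NumberField Module
open scoped IntermediateField

namespace Literature.NumberTheory.NumberFields

variable {K : Type} [Field K]

/-! ### `K̄` as an algebraic closure of `ℚ` -/

/-- `K̄` is an algebraic closure of `ℚ`. [folklore] -/
theorem isAlgClosure_rat_algebraicClosure [NumberField K] : IsAlgClosure ℚ (AlgebraicClosure K) :=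
  ⟨inferInstance, Algebra.IsAlgebraic.trans ℚ K (AlgebraicClosure K)⟩

/-- `K̄/ℚ` is normal. [folklore] -/
theorem normal_rat_algebraicClosure [NumberField K] : Normal ℚ (AlgebraicClosure K) := by
  haveI := isAlgClosure_rat_algebraicClosure (K := K)
  infer_instance

/-! ### Equalizers and preimages of intermediate fields under automorphisms -/

/-- The set where two `K`-automorphisms of `K̄` agree is an intermediate field. [folklore] -/
theorem exists_intermediateField_eqOn (A B : AlgebraicClosure K ≃ₐ[K] AlgebraicClosure K) :
    ∃ S : IntermediateField K (AlgebraicClosure K), ∀ y, y ∈ S ↔ A y = B y := by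
  refine ⟨(AlgHom.equalizer (A : AlgebraicClosure K →ₐ[K] AlgebraicClosure K) B).toIntermediateField
      fun y hy => ?_, fun y => ?_⟩
  · rw [AlgHom.mem_equalizer] at hy ⊢
    change A y⁻¹ = B y⁻¹
    change A y = B y at hy
    rw [map_inv₀, map_inv₀, hy]
  · change y ∈ AlgHom.equalizer _ _ ↔ _
    rw [AlgHom.mem_equalizer]
    rfl

/-- **Two `K`-automorphisms of `K̄` agreeing on `F₁` and on `F₂` agree on `F₁F₂`.** [folklore] -/
theorem eqOn_sup {F₁ F₂ : IntermediateField K (AlgebraicClosure K)}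
    (A B : AlgebraicClosure K ≃ₐ[K] AlgebraicClosure K)
    (h₁ : ∀ x ∈ F₁, A x = B x) (h₂ : ∀ x ∈ F₂, A x = B x) {x : AlgebraicClosure K}
    (hx : x ∈ F₁ ⊔ F₂) : A x = B x := by
  obtain ⟨S, hS⟩ := exists_intermediateField_eqOn A B
  have hle : F₁ ⊔ F₂ ≤ S :=
    sup_le (fun y hy => (hS y).mpr (h₁ y hy)) (fun y hy => (hS y).mpr (h₂ y hy))
  exact (hS x).mp (hle hx)

/-- The preimage of an intermediate field of `K̄/K` under a `ℚ`-automorphism of `K̄` is an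
intermediate field of `K̄/K` (when `K/ℚ` is normal, `g(K) = K`). [folklore] -/
theorem exists_intermediateField_comap [NumberField K] [IsGalois ℚ K]
    (f : AlgebraicClosure K ≃ₐ[ℚ] AlgebraicClosure K) (T : IntermediateField K (AlgebraicClosure K)) :
    ∃ S : IntermediateField K (AlgebraicClosure K), ∀ y, y ∈ S ↔ f y ∈ T := by
  refine ⟨(T.toSubfield.comap (f : AlgebraicClosure K →+* AlgebraicClosure K)).toIntermediateField
      fun y => ?_, fun y => ?_⟩
  · rw [Subfield.mem_comap]
    change f (algebraMap K _ y) ∈ T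
    rw [← AlgEquiv.restrictNormal_commutes]
    exact T.algebraMap_mem _
  · change y ∈ Subfield.comap _ _ ↔ _
    rw [Subfield.mem_comap]
    rfl

/-- **A `ℚ`-automorphism of `K̄` mapping `F₁` and `F₂` into `T` maps `F₁F₂` into `T`.** [folklore] -/
theorem apply_mem_sup_of [NumberField K] [IsGalois ℚ K] (f : AlgebraicClosure K ≃ₐ[ℚ] AlgebraicClosure K)
    {F₁ F₂ T : IntermediateField K (AlgebraicClosure K)}
    (h₁ : ∀ x ∈ F₁, f x ∈ T) (h₂ : ∀ x ∈ F₂, f x ∈ T) {x : AlgebraicClosure K}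
    (hx : x ∈ F₁ ⊔ F₂) : f x ∈ T := by
  obtain ⟨S, hS⟩ := exists_intermediateField_comap f T
  have hle : F₁ ⊔ F₂ ≤ S :=
    sup_le (fun y hy => (hS y).mpr (h₁ y hy)) (fun y hy => (hS y).mpr (h₂ y hy))
  exact (hS x).mp (hle hx)

/-- A `ℚ`-automorphism of `K̄` mapping `a` into `T` maps `K(a)` into `T`. [folklore] -/
theorem apply_mem_of_mem_adjoin [NumberField K] [IsGalois ℚ K] (f : AlgebraicClosure K ≃ₐ[ℚ] AlgebraicClosure K)
    {T : IntermediateField K (AlgebraicClosure K)} {a : AlgebraicClosure K} (ha : f a ∈ T)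
    {x : AlgebraicClosure K} (hx : x ∈ K⟮a⟯) : f x ∈ T := by
  obtain ⟨S, hS⟩ := exists_intermediateField_comap f T
  exact (hS x).mp (IntermediateField.adjoin_simple_le_iff.mpr ((hS a).mpr ha) hx)

/-! ### Cube roots of unity in `K̄` -/

/-- In a field, `a³ = b³` with `b ≠ 0` forces `a = ω b` for a cube root of unity `ω`. [folklore] -/
theorem exists_eq_mul_of_pow_three_eq {F : Type*} [Field F] {a b : F} (hb : b ≠ 0)
    (h : a ^ 3 = b ^ 3) : ∃ ω : F, ω ^ 3 = 1 ∧ a = ω * b :=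
  ⟨a / b, by rw [div_pow, h, div_self (pow_ne_zero 3 hb)], by rw [div_mul_cancel₀ a hb]⟩

section CubeRoots

variable {ζ : AlgebraicClosure K} (hζ : IsPrimitiveRoot ζ 3)

include hζ in
/-- The cube roots of unity in `K̄` are `1, ζ, ζ²`. [folklore] -/
theorem eq_of_pow_three_eq_one {ω : AlgebraicClosure K} (hω : ω ^ 3 = 1) :
    ω = 1 ∨ ω = ζ ∨ ω = ζ ^ 2 := by
  obtain ⟨i, hi, rfl⟩ := hζ.eq_pow_of_pow_eq_one hω
  interval_cases i
  · exact Or.inl (pow_zero ζ)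
  · exact Or.inr (Or.inl (pow_one ζ))
  · exact Or.inr (Or.inr rfl)

include hζ in
/-- The cube roots of unity lie in `K(ζ)`. [folklore] -/
theorem mem_adjoin_of_pow_three_eq_one {ω : AlgebraicClosure K} (hω : ω ^ 3 = 1) :
    ω ∈ K⟮ζ⟯ := by
  rcases eq_of_pow_three_eq_one hζ hω with h | h | h <;> rw [h]
  · exact one_mem _
  · exact IntermediateField.mem_adjoin_simple_self K ζ
  · exact pow_mem (IntermediateField.mem_adjoin_simple_self K ζ) 2

include hζ in
/-- An automorphism with `ζ ↦ ζ²` inverts every cube root of unity: `f(ω) = ω²`. [folklore] -/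
theorem apply_eq_sq_of_pow_three_eq_one {F : Type*} [Field F] [Algebra F (AlgebraicClosure K)]
    (f : AlgebraicClosure K ≃ₐ[F] AlgebraicClosure K) (hf : f ζ = ζ ^ 2)
    {ω : AlgebraicClosure K} (hω : ω ^ 3 = 1) : f ω = ω ^ 2 := by
  rcases eq_of_pow_three_eq_one hζ hω with h | h | h <;> rw [h]
  · rw [map_one, one_pow]
  · exact hf
  · rw [map_pow, hf]

include hζ in
/-- `ζ⁴ = ζ`. [folklore] -/
theorem pow_four_eq_self : ζ ^ 4 = ζ := by
  rw [pow_succ, hζ.pow_eq_one, one_mul]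

include hζ in
/-- `K(ζ)/K` is Galois (a cyclotomic extension). [folklore] -/
theorem isGalois_adjoin : IsGalois K K⟮ζ⟯ := by
  haveI := hζ.intermediateField_adjoin_isCyclotomicExtension K
  exact IsCyclotomicExtension.isGalois {3} K K⟮ζ⟯

variable (hζK : ζ ∉ Set.range (algebraMap K (AlgebraicClosure K)))

include hζ hζK in
/-- **The minimal polynomial of `ζ₃` over `K ∌ ζ₃` is `X² + X + 1`** (it divides it and is not
linear). [folklore] -/
theorem minpoly_eq : minpoly K ζ = Polynomial.X ^ 2 + Polynomial.X + 1 := by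
  have hint : IsIntegral K ζ := Algebra.IsIntegral.isIntegral ζ
  have hroot : Polynomial.aeval ζ (Polynomial.X ^ 2 + Polynomial.X + 1 : Polynomial K) = 0 := by
    -- `ζ² + ζ + 1 = 0` (`1 + ζ + ζ² = (ζ³ - 1)/(ζ - 1)`)
    have h := hζ.geom_sum_eq_zero (by norm_num : 1 < 3)
    simp only [Finset.sum_range_succ, Finset.sum_range_zero, pow_zero, pow_one, zero_add] at h
    simp only [map_add, map_pow, Polynomial.aeval_X, map_one]
    linear_combination h
  have hmonic : (Polynomial.X ^ 2 + Polynomial.X + 1 : Polynomial K).Monic := by monicity!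
  have h2 : (Polynomial.X ^ 2 + Polynomial.X + 1 : Polynomial K).natDegree = 2 := by compute_degree!
  have hle : 2 ≤ (minpoly K ζ).natDegree := by
    refine (minpoly.two_le_natDegree_iff hint).mpr fun h => hζK ?_
    obtain ⟨y, hy⟩ := RingHom.mem_range.mp h
    exact ⟨y, hy⟩
  exact (Polynomial.eq_of_monic_of_dvd_of_natDegree_le (minpoly.monic hint) hmonic
    (minpoly.dvd K ζ hroot) (by rw [h2]; exact hle)).symm

include hζ hζK in
/-- **`[K(ζ₃) : K] = 2` when `ζ₃ ∉ K`.** [folklore] -/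
theorem finrank_adjoin_eq_two : finrank K K⟮ζ⟯ = 2 := by
  have hint : IsIntegral K ζ := Algebra.IsIntegral.isIntegral ζ
  rw [IntermediateField.adjoin.finrank hint, minpoly_eq hζ hζK]
  compute_degree!

/-- `K(ζ)` is finite over `K`. [folklore] -/
theorem finiteDimensional_adjoin (ζ : AlgebraicClosure K) : FiniteDimensional K K⟮ζ⟯ :=
  IntermediateField.adjoin.finiteDimensional (Algebra.IsIntegral.isIntegral ζ)

include hζ hζK in
/-- **There is `φ ∈ Aut(K̄/K)` with `φ(ζ) = ζ²`**: the `K`-embedding `K(ζ) → K̄`, `ζ ↦ ζ²` (both roots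
of the minimal polynomial, which divides `X² + X + 1`) extends to the normal extension `K̄/K`.
[folklore] -/
theorem exists_algEquiv_apply_eq_sq :
    ∃ φ : AlgebraicClosure K ≃ₐ[K] AlgebraicClosure K, φ ζ = ζ ^ 2 := by
  have hint : IsIntegral K ζ := Algebra.IsIntegral.isIntegral ζ
  set pb := IntermediateField.adjoin.powerBasis hint with hpb
  have hroot2 : Polynomial.aeval (ζ ^ 2) (minpoly K pb.gen) = 0 := by
    rw [hpb, IntermediateField.adjoin.powerBasis_gen, IntermediateField.minpoly_gen,
      minpoly_eq hζ hζK]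
    have h := minpoly.aeval K ζ
    rw [minpoly_eq hζ hζK] at h
    simp only [map_add, map_pow, Polynomial.aeval_X, map_one] at h ⊢
    rw [← pow_mul, show 2 * 2 = 4 by rfl, pow_four_eq_self hζ]
    linear_combination h
  let ψ₀ : K⟮ζ⟯ →ₐ[K] AlgebraicClosure K := pb.lift (ζ ^ 2) hroot2
  have hψ₀ : ψ₀ pb.gen = ζ ^ 2 := pb.lift_gen _ _
  let ψ : AlgebraicClosure K →ₐ[K] AlgebraicClosure K := ψ₀.liftNormal (AlgebraicClosure K)
  refine ⟨AlgEquiv.ofBijective ψ (Algebra.IsAlgebraic.algHom_bijective ψ), ?_⟩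
  rw [AlgEquiv.ofBijective_apply]
  have hgen : algebraMap K⟮ζ⟯ (AlgebraicClosure K) pb.gen = ζ := by
    rw [hpb, IntermediateField.adjoin.powerBasis_gen, IntermediateField.AdjoinSimple.algebraMap_gen]
  calc ψ ζ = ψ (algebraMap K⟮ζ⟯ (AlgebraicClosure K) pb.gen) := by rw [hgen]
    _ = algebraMap (AlgebraicClosure K) (AlgebraicClosure K) (ψ₀ pb.gen) :=
        AlgHom.liftNormal_commutes ψ₀ (AlgebraicClosure K) pb.gen
    _ = ζ ^ 2 := by rw [hψ₀, Algebra.algebraMap_self, RingHom.id_apply]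

include hζ hζK in
/-- **For a quadratic field `K ∌ ζ₃` there is `g ∈ Aut(K̄/ℚ)` non-trivial on `K` with `g(ζ) = ζ²`**
(Washington's `στ ∈ Gal(K(ζ)/ℚ)`, generating `Gal(K(ζ)/ℚ(√-3d))`): lift the non-trivial element of
`Gal(K/ℚ)` to `K̄` and, if it fixes `ζ`, compose with `φ` of `exists_algEquiv_apply_eq_sq`.
[cite: Washington1997, Thm 10.10 (proof)] -/
theorem exists_algEquiv_restrictNormal_ne_one [NumberField K] [IsGalois ℚ K]
    (h2 : finrank ℚ K = 2) :
    ∃ g : AlgebraicClosure K ≃ₐ[ℚ] AlgebraicClosure K, g.restrictNormal K ≠ 1 ∧ g ζ = ζ ^ 2 := by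
  haveI := normal_rat_algebraicClosure (K := K)
  -- the non-trivial `τ ∈ Gal(K/ℚ)`
  have hcard : Nat.card (K ≃ₐ[ℚ] K) = 2 := by rw [IsGalois.card_aut_eq_finrank, h2]
  obtain ⟨τ, hτ⟩ : ∃ τ : K ≃ₐ[ℚ] K, τ ≠ 1 := by
    by_contra h
    push Not at h
    have : Nat.card (K ≃ₐ[ℚ] K) = 1 :=
      Nat.card_eq_one_iff_unique.mpr ⟨⟨fun a b => by rw [h a, h b]⟩, ⟨1⟩⟩
    omega
  let g₀ : AlgebraicClosure K ≃ₐ[ℚ] AlgebraicClosure K := τ.liftNormal (AlgebraicClosure K)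
  have hg₀K : ∀ x : K, g₀ (algebraMap K _ x) = algebraMap K _ (τ x) :=
    AlgEquiv.liftNormal_commutes τ (AlgebraicClosure K)
  have hne : ∀ f : AlgebraicClosure K ≃ₐ[ℚ] AlgebraicClosure K,
      (∀ x : K, f (algebraMap K _ x) = algebraMap K _ (τ x)) → f.restrictNormal K ≠ 1 := by
    intro f hf h1
    apply hτ
    ext x
    apply (algebraMap K (AlgebraicClosure K)).injective
    rw [← hf, ← AlgEquiv.restrictNormal_commutes, h1]
  have h3 : (g₀ ζ) ^ 3 = 1 := by rw [← map_pow, hζ.pow_eq_one, map_one]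
  rcases eq_of_pow_three_eq_one hζ h3 with h | h | h
  · exact absurd (g₀.injective (h.trans (map_one g₀).symm)) (hζ.ne_one (by norm_num))
  · obtain ⟨φ, hφ⟩ := exists_algEquiv_apply_eq_sq hζ hζK
    refine ⟨(φ.restrictScalars ℚ).trans g₀, hne _ fun x => ?_, ?_⟩
    · rw [AlgEquiv.trans_apply, AlgEquiv.restrictScalars_apply, AlgEquiv.commutes, hg₀K]
    · rw [AlgEquiv.trans_apply, AlgEquiv.restrictScalars_apply, hφ, map_pow, h]
  · exact ⟨g₀, hne _ hg₀K, h⟩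

include hζ in
/-- A `ℚ`-automorphism of `K̄` mapping `ζ` into `K(ζ)` preserves `K(ζ)`. [folklore] -/
theorem apply_mem_adjoin_of [NumberField K] [IsGalois ℚ K] (f : AlgebraicClosure K ≃ₐ[ℚ] AlgebraicClosure K)
    {x : AlgebraicClosure K} (hx : x ∈ K⟮ζ⟯) : f x ∈ K⟮ζ⟯ := by
  have h3 : (f ζ) ^ 3 = 1 := by rw [← map_pow, hζ.pow_eq_one, map_one]
  exact apply_mem_of_mem_adjoin f (mem_adjoin_of_pow_three_eq_one hζ h3) hx

include hζ in
/-- **`g²` is the identity on `K(ζ)`** for `g ∈ Aut(K̄/ℚ)` with `g(ζ) = ζ²` and `K` quadratic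
(`g²|_K = τ² = 1`, `g²(ζ) = ζ⁴ = ζ`). [folklore] -/
theorem apply_apply_eq_self_of_mem_adjoin [NumberField K] [IsGalois ℚ K] (h2 : finrank ℚ K = 2)
    (g : AlgebraicClosure K ≃ₐ[ℚ] AlgebraicClosure K) (hg : g ζ = ζ ^ 2)
    {x : AlgebraicClosure K} (hx : x ∈ K⟮ζ⟯) : g (g x) = x := by
  have hcard : Nat.card (K ≃ₐ[ℚ] K) = 2 := by rw [IsGalois.card_aut_eq_finrank, h2]
  have hK : ∀ y : K, (g.toRingEquiv.trans g.toRingEquiv) (algebraMap K (AlgebraicClosure K) y) =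
      algebraMap K (AlgebraicClosure K) y := by
    intro y
    change g (g (algebraMap K (AlgebraicClosure K) y)) = algebraMap K (AlgebraicClosure K) y
    rw [← AlgEquiv.restrictNormal_commutes, ← AlgEquiv.restrictNormal_commutes,
      ← AlgEquiv.mul_apply, ← sq, ← hcard, pow_card_eq_one', AlgEquiv.one_apply]
  let A : AlgebraicClosure K ≃ₐ[K] AlgebraicClosure K := AlgEquiv.ofRingEquiv hK
  have hA : ∀ y, A y = g (g y) := fun y => rfl
  obtain ⟨S, hS⟩ := exists_intermediateField_eqOn A 1
  have hζS : ζ ∈ S := (hS ζ).mpr (by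
    rw [hA, AlgEquiv.one_apply, hg, map_pow, hg, ← pow_mul]
    exact pow_four_eq_self hζ)
  have := (hS x).mp (IntermediateField.adjoin_simple_le_iff.mpr hζS hx)
  rwa [hA, AlgEquiv.one_apply] at this

include hζ hζK in
/-- **`[E(ζ) : K] = 6` for a cubic extension `E/K`** (degrees `3` and `2` are coprime, so `E` and
`K(ζ)` are linearly disjoint). [folklore] -/
theorem finrank_sup_adjoin_eq (E : IntermediateField K (AlgebraicClosure K)) [FiniteDimensional K E]
    (h3 : finrank K E = 3) : finrank K (E ⊔ K⟮ζ⟯ : IntermediateField K (AlgebraicClosure K)) = 6 := by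
  haveI := finiteDimensional_adjoin (K := K) ζ
  have hcop : (finrank K E).Coprime (finrank K K⟮ζ⟯) := by
    rw [h3, finrank_adjoin_eq_two hζ hζK]
    decide
  rw [(IntermediateField.LinearDisjoint.of_finrank_coprime hcop).finrank_sup, h3,
    finrank_adjoin_eq_two hζ hζK]

include hζ hζK in
/-- **Two cubic Galois extensions `E₁, E₂` of `K ∌ ζ₃` with `E₁ ⊆ E₂(ζ₃)` are equal.**  Otherwise
`[E₁E₂ : K] ∈ {3, 6}` divides `[E₂(ζ):K] = 6` and is `> 3`, so `E₁E₂ = E₂(ζ) ∋ ζ`; but every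
`φ ∈ Aut(K̄/K)` has `φ³ = 1` on `E₁` and on `E₂`, hence on `E₁E₂`, while `φ³(ζ) = ζ² ≠ ζ` for the
`φ` with `φ(ζ) = ζ²`.  (The uniqueness of the cubic subfield of `E(ζ₃)/K` in the proof of
Washington's Thm. 10.10.) [cite: Washington1997, Thm 10.10 (proof)] -/
theorem eq_of_le_sup_adjoin {E₁ E₂ : IntermediateField K (AlgebraicClosure K)}
    [FiniteDimensional K E₁] [IsGalois K E₁] [FiniteDimensional K E₂] [IsGalois K E₂]
    (h₁ : finrank K E₁ = 3) (h₂' : finrank K E₂ = 3)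
    (hle : E₁ ≤ E₂ ⊔ K⟮ζ⟯) : E₁ = E₂ := by
  haveI := finiteDimensional_adjoin (K := K) ζ
  have h6 : finrank K (E₂ ⊔ K⟮ζ⟯ : IntermediateField K (AlgebraicClosure K)) = 6 :=
    finrank_sup_adjoin_eq hζ hζK E₂ h₂'
  have hsuple : E₁ ⊔ E₂ ≤ E₂ ⊔ K⟮ζ⟯ := sup_le hle le_sup_left
  have hdvd6 : finrank K (E₁ ⊔ E₂ : IntermediateField K (AlgebraicClosure K)) ∣ 6 :=
    h6 ▸ IntermediateField.finrank_dvd_of_le_right hsuple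
  have hdvd3 : 3 ∣ finrank K (E₁ ⊔ E₂ : IntermediateField K (AlgebraicClosure K)) :=
    h₂' ▸ IntermediateField.finrank_dvd_of_le_right le_sup_right
  obtain ⟨m, hm⟩ := hdvd3
  have hm2 : m ∣ 2 := by
    have h := hdvd6
    rw [hm, show (6 : ℕ) = 3 * 2 by rfl] at h
    exact Nat.dvd_of_mul_dvd_mul_left (by norm_num) h
  rcases (Nat.dvd_prime Nat.prime_two).mp hm2 with rfl | rfl
  · -- `[E₁E₂ : K] = 3`
    have hE₂ : E₂ = E₁ ⊔ E₂ :=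
      IntermediateField.eq_of_le_of_finrank_eq le_sup_right (by rw [hm, h₂'])
    have hE₁ : E₁ = E₁ ⊔ E₂ :=
      IntermediateField.eq_of_le_of_finrank_eq le_sup_left (by rw [hm, h₁])
    rw [hE₁, ← hE₂]
  · -- `[E₁E₂ : K] = 6`, so `ζ ∈ E₁E₂`
    exfalso
    have heq : E₁ ⊔ E₂ = E₂ ⊔ K⟮ζ⟯ :=
      IntermediateField.eq_of_le_of_finrank_eq hsuple (by rw [hm, h6])
    have hζmem : ζ ∈ E₁ ⊔ E₂ := by
      rw [heq]
      exact (le_sup_right : K⟮ζ⟯ ≤ E₂ ⊔ K⟮ζ⟯) (IntermediateField.mem_adjoin_simple_self K ζ)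
    obtain ⟨φ, hφ⟩ := exists_algEquiv_apply_eq_sq hζ hζK
    have hfix : ∀ (E : IntermediateField K (AlgebraicClosure K)) [FiniteDimensional K E]
        [IsGalois K E], finrank K E = 3 → ∀ x ∈ E, (φ ^ 3) x = x := by
      intro E _ _ hE x hx
      have hc : Nat.card (E ≃ₐ[K] E) = 3 := by rw [IsGalois.card_aut_eq_finrank, hE]
      have hone : (AlgEquiv.restrictNormalHom E φ) ^ 3 = 1 := by rw [← hc]; exact pow_card_eq_one'
      have h := AlgEquiv.restrictNormalHom_apply E (φ ^ 3) ⟨x, hx⟩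
      rw [map_pow, hone, AlgEquiv.one_apply] at h
      exact h.symm
    have key := eqOn_sup (φ ^ 3) 1
      (fun x hx => by rw [hfix E₁ h₁ x hx, AlgEquiv.one_apply])
      (fun x hx => by rw [hfix E₂ h₂' x hx, AlgEquiv.one_apply]) hζmem
    have hφ2 : φ (ζ ^ 2) = ζ := by rw [map_pow, hφ, ← pow_mul]; exact pow_four_eq_self hζ
    rw [AlgEquiv.one_apply, pow_succ, pow_two, AlgEquiv.mul_apply, AlgEquiv.mul_apply, hφ, hφ2,
      hφ] at key
    have hζ0 : ζ ≠ 0 := hζ.ne_zero (by norm_num)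
    have hprod : ζ * (ζ - 1) = 0 := by linear_combination key
    rcases mul_eq_zero.mp hprod with h | h
    · exact hζ0 h
    · exact hζ.ne_one (by norm_num) (by linear_combination h)

end CubeRoots

end Literature.NumberTheory.NumberFields

end
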